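import Literature.MathematicalPhysics.KineticTheory.SeparableTwoBodyTMatrix
import Mathlib.MeasureTheory.Function.Holder
import Mathlib.MeasureTheory.Function.L2Space
import Mathlib.MeasureTheory.Integral.Bochner.ContinuousLinearMap
import Mathlib.MeasureTheory.Integral.DominatedConvergence
import Mathlib.Topology.Order.IntermediateValue
import HarnessLib

/-!
# Separable perturbations of a band (multiplication operator): resolvent, `g(z)` as an integral,
# and the bound state above a divergent band edge

Topic `Literature/MathematicalPhysics/KineticTheory` (definition request `defn-SeparableTwoBodyTMatrix`, part
(ii) of the request; the abstract T-matrix / Faddeev part is `SeparableTwoBodyTMatrix.lean`, the pinned-chain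
pair band `E_K(p) = ω(p) + ω(K − p)` on `𝕋` and the `(2,2)`-shell pair coordinates are `PhononPairBand.lean`).

THE INSTANCE. `(X, m)` a measure space, `E : X → ℝ` a bounded measurable BAND, `M_E = bandOp E` the
multiplication operator by `E` on `L²(m; ℂ)` (`Lp ℂ 2 m`), and `H_λ = M_E + λ Σ_i |u_i⟩⟨v_i|`
(`FiniteRank.perturb (bandOp E) λ u v`, abstract file). What is PROVED here:

* §1 `mulOp m F`: multiplication by an essentially bounded complex weight as a bounded operator on `L²(m; ℂ)`
  (Hölder action of `L∞`, same construction as `PinnedChainKinetic.multiplier` for real weights), with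
  `coeFn_mulOp`, composition `mulOp_mulOp`, `mulOp_sub`, `mulOp_const`, `mulOp_one`, and the matrix element
  `⟪f, mulOp F g⟫ = ∫ conj f · F · g` (`inner_mulOp`).
* §2 `bandOp E = mulOp (E : ℂ)`; for `z` at uniform distance `δ > 0` from the range of `E`:
  `z ∈ ρ(M_E)` and `(z − M_E)⁻¹ = mulOp (z − E)⁻¹` (`resolvent_bandOp`), hence the matrix of the abstract file
  is the familiar integral `g(z)_{ij} = ∫ conj(v_i) u_j /(z − E) dm` (`gMatrix_bandOp`)
  [cite: Economou1983, §1.2 eq. (1.31) and §6.1 (6.7)].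
* §3 ABOVE THE BAND, binding sign, rank one with `v = u`: for real `x > sup E`,
  `⟪u, (x − M_E)⁻¹ u⟫ = g(x) := ∫ ‖u‖²/(x − E) dm` (`edgeFn`, `inner_resolvent_bandOp_self`), and `g` is
  `≥ 0`, antitone, STRICTLY antitone if `u ≠ 0`, continuous on `(sup E, ∞)`, `≤ ‖u‖²/(x − sup E) → 0`
  [cite: Economou1983, §6.2 eqs. (6.38)–(6.39) and (1.31) (`G₀' < 0` off the band)].
* §4 THE DIVERGENT (one-dimensional van Hove) EDGE: if the threshold integral diverges,
  `∫⁻ ‖u‖²/(sup E − E) dm = ∞` (in 1-D this is the `(E_max − E)^{-1/2}` density of states at a quadratic band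
  edge, Economou (6.46)–(6.47); the circle instance is `BandEdgeVanHove.lean`), then `g(x) ↑ ∞` as
  `x ↓ sup E` (`edgeFn_unbounded`, monotone convergence), and CONSEQUENTLY, for EVERY coupling `λ > 0` the
  rank-one operator `M_E + λ|u⟩⟨u|` has EXACTLY ONE eigenvalue above the band, the unique root of
  `λ g(x) = 1` (`existsUnique_eigenvalue_above`), while for `λ ≤ 0` it has none there
  (`no_eigenvalue_above_of_nonpos`) — "in 1-D there is always a bound state no matter how small |ε| is"
  [cite: Economou1983, §6.2.3 eqs. (6.46)–(6.48) with §6.1 eq. (6.9)]. (Mirror statement below the band for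
  `λ < 0` by `E ↦ −E`.)

## What is NOT here

* The ASYMPTOTICS `g(x) = c (x − E_max)^{-1/2}(1 + o(1))` and the binding-energy law `Δ(λ) ≍ λ²`
  (Economou (6.47)–(6.48)) — only the divergence and its spectral consequence are formalised; the rank-two
  version is the `2 × 2` determinant `fredholmDet` of the abstract file (no separate statement here).
* Self-adjointness / reality of the spectrum of `H_λ` (not needed: eigenvalues off `σ(M_E)` are located by
  the determinant for any `λ ∈ ℂ`).

## References

* E. N. Economou, Green's Functions in Quantum Physics, 2nd ed., Springer 1983, §1.2 (1.31), §6.1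
  (6.6)–(6.9), §6.2 (6.38)–(6.39), §6.2.3 (6.46)–(6.48). [cite: Economou1983, §6.1–6.2]
* T. Kato, Perturbation Theory for Linear Operators, 1966, Ch. IV §6. [cite: Kato1966, Ch. IV §6]
-/

noncomputable section

open MeasureTheory Filter Set
open scoped InnerProductSpace ComplexConjugate ENNReal Topology

namespace Literature.MathematicalPhysics.KineticTheory

namespace FiniteRank

variable {X : Type*} [MeasurableSpace X] (m : Measure X)

/-! ## §1. Bounded multiplication operators on `L²(m; ℂ)` -/

/-- An essentially bounded, a.e.-strongly measurable complex weight. [folklore] -/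
def IsBddMul (F : X → ℂ) : Prop :=
  AEStronglyMeasurable F m ∧ ∃ C : ℝ, ∀ᵐ x ∂m, ‖F x‖ ≤ C

variable {m}

/-- A pointwise bounded measurable weight is essentially bounded. [folklore] -/
theorem IsBddMul.of_bound {F : X → ℂ} (hF : AEStronglyMeasurable F m) {C : ℝ} (hC : ∀ x, ‖F x‖ ≤ C) :
    IsBddMul m F :=
  ⟨hF, C, ae_of_all _ hC⟩

/-- An essentially bounded weight is in `L∞`. [folklore] -/
theorem IsBddMul.memLp_top {F : X → ℂ} (h : IsBddMul m F) : MemLp F ∞ m :=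
  memLp_top_of_bound h.1 h.2.choose h.2.choose_spec

/-- Constants are bounded weights. [folklore] -/
theorem IsBddMul.const (c : ℂ) : IsBddMul m (fun _ : X => c) :=
  ⟨aestronglyMeasurable_const, ‖c‖, ae_of_all _ fun _ => le_rfl⟩

/-- Products of bounded weights are bounded. [folklore] -/
theorem IsBddMul.mul {F G : X → ℂ} (hF : IsBddMul m F) (hG : IsBddMul m G) : IsBddMul m (F * G) := by
  obtain ⟨hFm, C, hC⟩ := hF
  obtain ⟨hGm, D, hD⟩ := hG
  refine ⟨hFm.mul hGm, C * D, ?_⟩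
  filter_upwards [hC, hD] with x h1 h2
  rw [Pi.mul_apply, norm_mul]
  exact mul_le_mul h1 h2 (norm_nonneg _) ((norm_nonneg _).trans h1)

/-- Differences of bounded weights are bounded. [folklore] -/
theorem IsBddMul.sub {F G : X → ℂ} (hF : IsBddMul m F) (hG : IsBddMul m G) : IsBddMul m (F - G) := by
  obtain ⟨hFm, C, hC⟩ := hF
  obtain ⟨hGm, D, hD⟩ := hG
  refine ⟨hFm.sub hGm, C + D, ?_⟩
  filter_upwards [hC, hD] with x h1 h2
  rw [Pi.sub_apply]
  exact (norm_sub_le _ _).trans (add_le_add h1 h2)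

variable (m)

open Classical in
/-- **Multiplication by an essentially bounded complex weight `F`** as a bounded operator on `L²(m; ℂ)`
(Hölder action of `L∞` on `L²`; junk value `0` when `F` is not essentially bounded). [folklore] -/
def mulOp (F : X → ℂ) : Lp ℂ 2 m →L[ℂ] Lp ℂ 2 m :=
  if h : IsBddMul m F then
    ((ContinuousLinearMap.mul ℂ ℂ).holderL m 2 ∞ 2).flip (h.memLp_top.toLp F)
  else 0

variable {m}

/-- `mulOp F g = F · g` almost everywhere. [folklore] -/
theorem coeFn_mulOp {F : X → ℂ} (h : IsBddMul m F) (g : Lp ℂ 2 m) :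
    mulOp m F g =ᵐ[m] fun x => F x * g x := by
  unfold mulOp
  rw [dif_pos h]
  simp only [ContinuousLinearMap.flip_apply, ContinuousLinearMap.holderL_apply_apply]
  filter_upwards [(ContinuousLinearMap.mul ℂ ℂ).coeFn_holder (r := 2) g (h.memLp_top.toLp F),
    h.memLp_top.coeFn_toLp] with x hx hF
  rw [hx, ContinuousLinearMap.mul_apply', hF, mul_comm]

/-- Composition: `F · (G · g) = (F G) · g`. [folklore] -/
theorem mulOp_mulOp {F G : X → ℂ} (hF : IsBddMul m F) (hG : IsBddMul m G) (g : Lp ℂ 2 m) :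
    mulOp m F (mulOp m G g) = mulOp m (F * G) g := by
  apply Lp.ext
  filter_upwards [coeFn_mulOp hF (mulOp m G g), coeFn_mulOp hG g, coeFn_mulOp (hF.mul hG) g]
    with x h1 h2 h3
  rw [h1, h2, h3, Pi.mul_apply, mul_assoc]

/-- `1 · g = g`. [folklore] -/
theorem mulOp_one (g : Lp ℂ 2 m) : mulOp m (fun _ : X => (1 : ℂ)) g = g := by
  apply Lp.ext
  filter_upwards [coeFn_mulOp (IsBddMul.const (m := m) 1) g] with x hx
  rw [hx, one_mul]

/-- `c · g = c • g` for a constant weight. [folklore] -/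
theorem mulOp_const (c : ℂ) (g : Lp ℂ 2 m) : mulOp m (fun _ : X => c) g = c • g := by
  apply Lp.ext
  filter_upwards [coeFn_mulOp (IsBddMul.const (m := m) c) g, Lp.coeFn_smul c g] with x h1 h2
  rw [h1, h2, Pi.smul_apply, smul_eq_mul]

/-- `(F − G) · g = F · g − G · g`. [folklore] -/
theorem mulOp_sub {F G : X → ℂ} (hF : IsBddMul m F) (hG : IsBddMul m G) (g : Lp ℂ 2 m) :
    mulOp m (F - G) g = mulOp m F g - mulOp m G g := by
  apply Lp.ext
  filter_upwards [coeFn_mulOp (hF.sub hG) g, coeFn_mulOp hF g, coeFn_mulOp hG g,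
    Lp.coeFn_sub (mulOp m F g) (mulOp m G g)] with x h1 h2 h3 h4
  rw [h1, h4, Pi.sub_apply, Pi.sub_apply, h2, h3, sub_mul]

/-- Matrix elements: `⟪f, F · g⟫ = ∫ conj(f) F g dm`. [folklore] -/
theorem inner_mulOp {F : X → ℂ} (hF : IsBddMul m F) (f g : Lp ℂ 2 m) :
    ⟪f, mulOp m F g⟫_ℂ = ∫ x, conj (f x) * (F x * g x) ∂m := by
  rw [L2.inner_def]
  refine integral_congr_ae ?_
  filter_upwards [coeFn_mulOp hF g] with x hx
  rw [hx, RCLike.inner_apply']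

/-! ## §2. The band `M_E` and its resolvent off the range -/

/-- **The band as a multiplication operator** `M_E` on `L²(m; ℂ)`, `E : X → ℝ` (junk `0` unless `E` is
essentially bounded and measurable). [cite: Economou1983, §1.2] -/
def bandOp (m : Measure X) (E : X → ℝ) : Lp ℂ 2 m →L[ℂ] Lp ℂ 2 m := mulOp m (fun x => (E x : ℂ))

/-- A bounded measurable real band is a bounded weight. [folklore] -/
theorem isBddMul_ofReal {E : X → ℝ} (hE : Measurable E) {B : ℝ} (hB : ∀ x, |E x| ≤ B) :
    IsBddMul m (fun x => (E x : ℂ)) :=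
  IsBddMul.of_bound (Complex.measurable_ofReal.comp hE).aestronglyMeasurable fun x => by
    rw [Complex.norm_real, Real.norm_eq_abs]; exact hB x

/-- The resolvent weight `(z − E)⁻¹` is bounded by `δ⁻¹` when `‖z − E‖ ≥ δ > 0`. [folklore] -/
theorem isBddMul_resolventWeight {E : X → ℝ} (hE : Measurable E) {z : ℂ} {δ : ℝ} (hδ : 0 < δ)
    (hz : ∀ x, δ ≤ ‖z - E x‖) : IsBddMul m (fun x => (z - (E x : ℂ))⁻¹) := by
  refine IsBddMul.of_bound ((measurable_const.sub (Complex.measurable_ofReal.comp hE)).inv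
    |>.aestronglyMeasurable) (C := δ⁻¹) fun x => ?_
  rw [norm_inv]
  exact inv_anti₀ hδ (hz x)

/-- `z•1 − M_E = M_{z − E}`. [folklore] -/
theorem sub_bandOp_eq {E : X → ℝ} (hE : Measurable E) {B : ℝ} (hB : ∀ x, |E x| ≤ B) (z : ℂ) :
    z • (1 : Lp ℂ 2 m →L[ℂ] Lp ℂ 2 m) - bandOp m E = mulOp m (fun x => z - (E x : ℂ)) := by
  ext1 g
  rw [sub_apply, smul_apply, one_apply_eq_self, bandOp,
    show (fun x => z - (E x : ℂ)) = (fun _ => z) - fun x => (E x : ℂ) from rfl,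
    mulOp_sub (IsBddMul.const z) (isBddMul_ofReal hE hB), mulOp_const]

/-- A two-sided inverse identifies the resolvent (generic algebra). [folklore] -/
theorem resolvent_eq_of_mul_eq_one {A : Type*} [Ring A] [Algebra ℂ A] {a w : A} {z : ℂ}
    (h1 : (algebraMap ℂ A z - a) * w = 1) (h2 : w * (algebraMap ℂ A z - a) = 1) :
    z ∈ resolventSet ℂ a ∧ resolvent a z = w := by
  refine ⟨spectrum.mem_resolventSet_of_left_right_inverse h1 h2, ?_⟩
  let U : Aˣ := ⟨_, w, h1, h2⟩
  change Ring.inverse (U : A) = w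
  rw [Ring.inverse_unit]
  rfl

/-- **Resolvent of the band.** If `‖z − E(x)‖ ≥ δ > 0` for all `x` (uniform distance from the range), then
`z ∈ ρ(M_E)` and `(z − M_E)⁻¹ = M_{(z − E)⁻¹}`. [cite: Economou1983, §1.2 eqs. (1.8)–(1.13)] -/
theorem resolvent_bandOp {E : X → ℝ} (hE : Measurable E) {B : ℝ} (hB : ∀ x, |E x| ≤ B) {z : ℂ} {δ : ℝ}
    (hδ : 0 < δ) (hz : ∀ x, δ ≤ ‖z - E x‖) :
    z ∈ resolventSet ℂ (bandOp m E) ∧ resolvent (bandOp m E) z = mulOp m (fun x => (z - (E x : ℂ))⁻¹) := by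
  have hW := isBddMul_resolventWeight (m := m) hE hδ hz
  have hS : IsBddMul m (fun x => z - (E x : ℂ)) := (IsBddMul.const z).sub (isBddMul_ofReal hE hB)
  have hne : ∀ x, z - (E x : ℂ) ≠ 0 := fun x h => by
    have := hz x; rw [h, norm_zero] at this; exact absurd this (not_le.2 hδ)
  have hmul : ((fun x => z - (E x : ℂ)) * fun x => (z - (E x : ℂ))⁻¹) = fun _ => 1 :=
    funext fun x => mul_inv_cancel₀ (hne x)
  have hmul' : ((fun x => (z - (E x : ℂ))⁻¹) * fun x => z - (E x : ℂ)) = fun _ => 1 :=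
    funext fun x => inv_mul_cancel₀ (hne x)
  apply resolvent_eq_of_mul_eq_one
  · rw [Algebra.algebraMap_eq_smul_one, sub_bandOp_eq hE hB]
    ext1 g
    rw [mul_apply_eq_comp, one_apply_eq_self, mulOp_mulOp hS hW, hmul, mulOp_one]
  · rw [Algebra.algebraMap_eq_smul_one, sub_bandOp_eq hE hB]
    ext1 g
    rw [mul_apply_eq_comp, one_apply_eq_self, mulOp_mulOp hW hS, hmul', mulOp_one]

/-- **`g(z)` of the band is the familiar integral**: `g(z)_{ij} = ∫ conj(v_i) u_j/(z − E) dm` for `z` at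
positive distance from the range of `E`. [cite: Economou1983, §6.1 eq. (6.7) with §1.2 (1.31)] -/
theorem gMatrix_bandOp {ι : Type*} {E : X → ℝ} (hE : Measurable E) {B : ℝ} (hB : ∀ x, |E x| ≤ B) {z : ℂ}
    {δ : ℝ} (hδ : 0 < δ) (hz : ∀ x, δ ≤ ‖z - E x‖) (u v : ι → Lp ℂ 2 m) (i j : ι) :
    gMatrix (bandOp m E) u v z i j = ∫ x, conj (v i x) * ((z - (E x : ℂ))⁻¹ * u j x) ∂m := by
  rw [gMatrix_apply, (resolvent_bandOp hE hB hδ hz).2, inner_mulOp (isBddMul_resolventWeight hE hδ hz)]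

/-! ## §3. Above the band: `g(x) = ⟪u, (x − M_E)⁻¹u⟫ = ∫ ‖u‖²/(x − E)` -/

/-- **The edge function** `g(x) = ∫ ‖u‖²/(x − E) dm` of the band `E` and the form factor `u` (meaningful
for real `x` above `sup E`; Economou's `G₀(ℓ,ℓ;E)` outside the band). [cite: Economou1983, §6.2 eq. (6.39)] -/
def edgeFn (m : Measure X) (E : X → ℝ) (u : Lp ℂ 2 m) (x : ℝ) : ℝ := ∫ p, ‖u p‖ ^ 2 / (x - E p) ∂m

/-- `‖u‖²` is integrable for `u ∈ L²`. [folklore] -/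
theorem integrable_norm_sq (u : Lp ℂ 2 m) : Integrable (fun p => ‖u p‖ ^ 2) m :=
  (memLp_two_iff_integrable_sq_norm (Lp.aestronglyMeasurable u)).1 (Lp.memLp u)

section Above

variable {E : X → ℝ} {Emax : ℝ}

omit [MeasurableSpace X] in
/-- Above the band the real point `x` is at distance `x − E_max` from the range. [folklore] -/
theorem dist_le_of_above (hEmax : ∀ p, E p ≤ Emax) {x : ℝ} (hx : Emax < x) (p : X) :
    x - Emax ≤ ‖(x : ℂ) - E p‖ := by
  rw [← Complex.ofReal_sub, Complex.norm_real, Real.norm_eq_abs, abs_of_pos (by linarith [hEmax p])]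
  linarith [hEmax p]

/-- The integrand `‖u‖²/(x − E)` is integrable above the band. [folklore] -/
theorem integrable_edge (hE : Measurable E) (hEmax : ∀ p, E p ≤ Emax) {x : ℝ} (hx : Emax < x)
    (u : Lp ℂ 2 m) : Integrable (fun p => ‖u p‖ ^ 2 / (x - E p)) m := by
  have h : (fun p => ‖u p‖ ^ 2 / (x - E p)) = fun p => (x - E p)⁻¹ * ‖u p‖ ^ 2 := by
    funext p; rw [div_eq_inv_mul]
  rw [h]
  refine (integrable_norm_sq u).bdd_mul (c := (x - Emax)⁻¹)
    ((measurable_const.sub hE).inv.aestronglyMeasurable) (ae_of_all _ fun p => ?_)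
  have h1 : 0 < x - E p := by linarith [hEmax p]
  rw [Real.norm_eq_abs, abs_of_pos (inv_pos.2 h1)]
  exact inv_anti₀ (by linarith) (by linarith [hEmax p])

/-- **`⟪u, (x − M_E)⁻¹ u⟫ = g(x)`** for real `x` above the band. [cite: Economou1983, §6.1 eq. (6.7)] -/
theorem inner_resolvent_bandOp_self (hE : Measurable E) {B : ℝ} (hB : ∀ p, |E p| ≤ B)
    (hEmax : ∀ p, E p ≤ Emax) {x : ℝ} (hx : Emax < x) (u : Lp ℂ 2 m) :
    ⟪u, resolvent (bandOp m E) (x : ℂ) u⟫_ℂ = (edgeFn m E u x : ℂ) := by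
  have hz := dist_le_of_above hEmax hx
  rw [(resolvent_bandOp hE hB (sub_pos.2 hx) hz).2,
    inner_mulOp (isBddMul_resolventWeight hE (sub_pos.2 hx) hz), edgeFn, ← integral_complex_ofReal]
  refine integral_congr_ae (ae_of_all _ fun p => ?_)
  dsimp only
  rw [← mul_assoc, mul_comm (conj (u p)), mul_assoc, Complex.conj_mul', ← Complex.ofReal_sub,
    ← Complex.ofReal_inv, div_eq_inv_mul]
  push_cast
  ring

/-- `g(x) ≥ 0` above the band. [cite: Economou1983, §6.2 eq. (6.39)] -/
theorem edgeFn_nonneg (hEmax : ∀ p, E p ≤ Emax) {x : ℝ} (hx : Emax < x) (u : Lp ℂ 2 m) :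
    0 ≤ edgeFn m E u x :=
  integral_nonneg fun p => div_nonneg (sq_nonneg _) (by linarith [hEmax p])

/-- `g(x) ≤ ‖u‖²_{L²}/(x − E_max)`: `g` decays at infinity. [cite: Economou1983, §6.1 after eq. (6.19)] -/
theorem edgeFn_le_div (hE : Measurable E) (hEmax : ∀ p, E p ≤ Emax) {x : ℝ} (hx : Emax < x)
    (u : Lp ℂ 2 m) : edgeFn m E u x ≤ (∫ p, ‖u p‖ ^ 2 ∂m) / (x - Emax) := by
  rw [edgeFn, ← integral_div]
  refine integral_mono (integrable_edge hE hEmax hx u) ((integrable_norm_sq u).div_const _) fun p => ?_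
  exact div_le_div_of_nonneg_left (sq_nonneg _) (by linarith) (by linarith [hEmax p])

/-- `g` is ANTITONE above the band. [cite: Economou1983, §1.2 eq. (1.31)] -/
theorem edgeFn_antitone (hE : Measurable E) (hEmax : ∀ p, E p ≤ Emax) {x y : ℝ} (hx : Emax < x)
    (hxy : x ≤ y) (u : Lp ℂ 2 m) : edgeFn m E u y ≤ edgeFn m E u x :=
  integral_mono (integrable_edge hE hEmax (hx.trans_le hxy) u) (integrable_edge hE hEmax hx u) fun p =>
    div_le_div_of_nonneg_left (sq_nonneg _) (by linarith [hEmax p]) (by linarith)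

/-- `g` is STRICTLY antitone above the band when `u ≠ 0` (`G₀' < 0` off the band).
[cite: Economou1983, §1.2 eq. (1.31)] -/
theorem edgeFn_strictAnti (hE : Measurable E) (hEmax : ∀ p, E p ≤ Emax) {x y : ℝ} (hx : Emax < x)
    (hxy : x < y) {u : Lp ℂ 2 m} (hu : u ≠ 0) : edgeFn m E u y < edgeFn m E u x := by
  rw [← sub_pos, edgeFn, edgeFn, ← integral_sub (integrable_edge hE hEmax hx u)
    (integrable_edge hE hEmax (hx.trans hxy) u)]
  have hnn : 0 ≤ᵐ[m] fun p => ‖u p‖ ^ 2 / (x - E p) - ‖u p‖ ^ 2 / (y - E p) :=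
    ae_of_all _ fun p => sub_nonneg.2
      (div_le_div_of_nonneg_left (sq_nonneg _) (by linarith [hEmax p]) (by linarith))
  rw [integral_pos_iff_support_of_nonneg_ae hnn ((integrable_edge hE hEmax hx u).sub
    (integrable_edge hE hEmax (hx.trans hxy) u))]
  -- the support is `{u ≠ 0}`, which has positive measure since `u ≠ 0` in `L²`
  have hsupp : Function.support (fun p => ‖u p‖ ^ 2 / (x - E p) - ‖u p‖ ^ 2 / (y - E p)) =
      Function.support (u : X → ℂ) := by
    ext p
    simp only [Function.mem_support, ne_eq]
    have h1 : 0 < x - E p := by linarith [hEmax p]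
    have h2 : 0 < y - E p := by linarith [hEmax p]
    have hpos : 0 < (x - E p)⁻¹ - (y - E p)⁻¹ := sub_pos.2 ((inv_lt_inv₀ h2 h1).2 (by linarith))
    have hfac : ‖u p‖ ^ 2 / (x - E p) - ‖u p‖ ^ 2 / (y - E p) =
        ‖u p‖ ^ 2 * ((x - E p)⁻¹ - (y - E p)⁻¹) := by
      rw [mul_sub, ← div_eq_mul_inv, ← div_eq_mul_inv]
    rw [hfac, mul_eq_zero, not_or, pow_eq_zero_iff two_ne_zero, norm_eq_zero]
    exact ⟨fun h => h.1, fun h => ⟨h, hpos.ne'⟩⟩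
  rw [hsupp]
  by_contra hle
  apply hu
  rw [Lp.eq_zero_iff_ae_eq_zero]
  have h0 : m (Function.support (u : X → ℂ)) = 0 := nonpos_iff_eq_zero.1 (not_lt.1 hle)
  filter_upwards [measure_eq_zero_iff_ae_notMem.1 h0] with p hp
  simpa [Function.mem_support] using hp

/-- `g` is continuous on `(E_max, ∞)` (dominated convergence). [folklore] -/
theorem continuousOn_edgeFn (hE : Measurable E) (hEmax : ∀ p, E p ≤ Emax) (u : Lp ℂ 2 m) :
    ContinuousOn (edgeFn m E u) (Ioi Emax) := by
  refine continuousOn_of_forall_continuousAt fun x₀ hx₀ => ?_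
  have hx₀' : Emax < x₀ := hx₀
  set x₁ := (x₀ + Emax) / 2 with hx₁
  have h1 : Emax < x₁ := by rw [hx₁]; linarith
  have h10 : x₁ < x₀ := by rw [hx₁]; linarith
  have hnhds : Ioi x₁ ∈ 𝓝 x₀ := Ioi_mem_nhds h10
  refine continuousAt_of_dominated (bound := fun p => ‖u p‖ ^ 2 / (x₁ - Emax)) ?_ ?_ ?_ ?_
  · filter_upwards [hnhds] with x hx
    exact (integrable_edge hE hEmax (h1.trans hx) u).aestronglyMeasurable
  · filter_upwards [hnhds] with x hx
    refine ae_of_all _ fun p => ?_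
    have hx1 : x₁ < x := hx
    have hx' : Emax < x := h1.trans hx1
    rw [Real.norm_eq_abs, abs_of_nonneg (div_nonneg (sq_nonneg _) (by linarith [hEmax p]))]
    exact div_le_div_of_nonneg_left (sq_nonneg _) (by linarith) (by linarith [hEmax p])
  · exact (integrable_norm_sq u).div_const _
  · refine ae_of_all _ fun p => ?_
    have : x₀ - E p ≠ 0 := by linarith [hEmax p]
    exact continuousAt_const.div₀ (continuousAt_id.sub continuousAt_const) this

/-! ## §4. The divergent edge: `g ↑ ∞` at the threshold and the bound state for every `λ > 0` -/

/-- **Divergent threshold ⇒ `g` unbounded near the edge** (monotone convergence): if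
`∫⁻ ‖u‖²/(E_max − E) = ∞` then for every `B` there is `x > E_max` with `g(x) ≥ B` (and then `g ≥ B` on
`(E_max, x]` by antitonicity). [cite: Economou1983, §6.2.3 eq. (6.47)] -/
theorem edgeFn_unbounded (hE : Measurable E) (hEmax : ∀ p, E p ≤ Emax) (u : Lp ℂ 2 m)
    (hdiv : ∫⁻ p, ENNReal.ofReal (‖u p‖ ^ 2 / (Emax - E p)) ∂m = ∞) (B : ℝ) :
    ∃ x, Emax < x ∧ B ≤ edgeFn m E u x := by
  -- the increasing sequence f_n = ‖u‖²/(x_n − E), x_n = E_max + 1/(n+1)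
  set xs : ℕ → ℝ := fun n => Emax + 1 / ((n : ℝ) + 1) with hxs
  have hxpos : ∀ n, Emax < xs n := fun n => by
    rw [hxs]; simp only; have : (0 : ℝ) < 1 / ((n : ℝ) + 1) := by positivity
    linarith
  have hxanti : ∀ {k n : ℕ}, k ≤ n → xs n ≤ xs k := fun {k n} hkn => by
    rw [hxs]; simp only
    have : (1 : ℝ) / ((n : ℝ) + 1) ≤ 1 / ((k : ℝ) + 1) :=
      one_div_le_one_div_of_le (by positivity) (by exact_mod_cast Nat.succ_le_succ hkn)
    linarith
  set f : ℕ → X → ℝ≥0∞ := fun n p => ENNReal.ofReal (‖u p‖ ^ 2 / (xs n - E p)) with hf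
  have hfmeas : ∀ n, AEMeasurable (f n) m := fun n =>
    (integrable_edge hE hEmax (hxpos n) u).aestronglyMeasurable.aemeasurable.ennreal_ofReal
  have hfmono : ∀ p, Monotone fun n => f n p := fun p k n hkn => by
    simp only [hf]
    exact ENNReal.ofReal_le_ofReal (div_le_div_of_nonneg_left (sq_nonneg _)
      (by linarith [hEmax p, hxpos n]) (by linarith [hxanti hkn]))
  -- pointwise the supremum dominates the threshold integrand
  have hdom : ∀ p, ENNReal.ofReal (‖u p‖ ^ 2 / (Emax - E p)) ≤ ⨆ n, f n p := by
    intro p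
    rcases eq_or_lt_of_le (hEmax p) with h | h
    · rw [h, sub_self, div_zero, ENNReal.ofReal_zero]; exact bot_le
    · -- E p < Emax: f_n p → ofReal (‖u p‖²/(Emax − E p)), and the limit of a monotone sequence is its sup
      have hx : Tendsto xs atTop (𝓝 Emax) := by
        have := tendsto_one_div_add_atTop_nhds_zero_nat.const_add Emax
        simpa [hxs] using this
      have hq : Tendsto (fun n => ‖u p‖ ^ 2 / (xs n - E p)) atTop (𝓝 (‖u p‖ ^ 2 / (Emax - E p))) :=
        tendsto_const_nhds.div (hx.sub_const (E p)) (by linarith)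
      have htend : Tendsto (fun n => f n p) atTop (𝓝 (ENNReal.ofReal (‖u p‖ ^ 2 / (Emax - E p)))) :=
        (ENNReal.continuous_ofReal.tendsto _).comp hq
      exact le_of_eq (tendsto_nhds_unique htend (tendsto_atTop_iSup (hfmono p)))
  -- monotone convergence: ⨆ ∫ f_n = ∫ ⨆ f_n ≥ ∫ threshold = ∞
  have hsup : ⨆ n, ∫⁻ p, f n p ∂m = ∞ := by
    rw [← lintegral_iSup' hfmeas (ae_of_all _ hfmono)]
    exact eq_top_iff.2 (hdiv ▸ lintegral_mono hdom)
  -- pick n with ∫ f_n > B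
  have hlt : ENNReal.ofReal B < ⨆ n, ∫⁻ p, f n p ∂m := by rw [hsup]; exact ENNReal.ofReal_lt_top
  obtain ⟨n, hn⟩ := lt_iSup_iff.1 hlt
  refine ⟨xs n, hxpos n, ?_⟩
  have heq : ∫⁻ p, f n p ∂m = ENNReal.ofReal (edgeFn m E u (xs n)) := by
    rw [edgeFn, ofReal_integral_eq_lintegral_ofReal (integrable_edge hE hEmax (hxpos n) u)
      (ae_of_all _ fun p => div_nonneg (sq_nonneg _) (by linarith [hEmax p, hxpos n]))]
  rw [heq] at hn
  by_contra hlt'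
  exact (not_le.2 hn) (ENNReal.ofReal_le_ofReal (not_le.1 hlt').le)

/-- Intermediate-value step: a continuous strictly antitone function on `(a, ∞)` that is unbounded at `a⁺`
and small at infinity takes every positive value exactly once. [folklore] -/
theorem existsUnique_of_strictAnti_surj {g : ℝ → ℝ} {a c : ℝ} (hcont : ContinuousOn g (Ioi a))
    (hanti : ∀ x y, a < x → x < y → g y < g x) (hlarge : ∃ x, a < x ∧ c ≤ g x)
    (hsmall : ∃ y, a < y ∧ g y < c) : ∃! x, a < x ∧ g x = c := by
  obtain ⟨x₁, hx₁, h₁⟩ := hlarge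
  obtain ⟨x₂, hx₂, h₂⟩ := hsmall
  have h12 : x₁ < x₂ := by
    by_contra h
    rcases eq_or_lt_of_le (not_lt.1 h) with h' | h'
    · rw [h'] at h₂; linarith
    · linarith [hanti x₂ x₁ hx₂ h']
  have hsub : Icc x₁ x₂ ⊆ Ioi a := fun x hx => lt_of_lt_of_le hx₁ hx.1
  obtain ⟨x, hx, hgx⟩ := intermediate_value_Icc' h12.le (hcont.mono hsub) ⟨h₂.le, h₁⟩
  refine ⟨x, ⟨hsub hx, hgx⟩, fun y ⟨hy, hgy⟩ => ?_⟩
  by_contra hne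
  rcases lt_or_gt_of_ne hne with h | h
  · have := hanti y x hy h; rw [hgx, hgy] at this; exact lt_irrefl _ this
  · have := hanti x y (hsub hx) h; rw [hgx, hgy] at this; exact lt_irrefl _ this

/-- **THE BOUND STATE ABOVE A DIVERGENT BAND EDGE (every `λ > 0` binds).** Let `E` be a bounded measurable
band with `E ≤ E_max`, `u ∈ L²(m)`, `u ≠ 0`, and suppose the threshold integral diverges,
`∫⁻ ‖u‖²/(E_max − E) dm = ∞` (the one-dimensional van Hove edge). Then for every `λ > 0` the rank-one
operator `M_E + λ|u⟩⟨u|` has EXACTLY ONE eigenvalue `x > E_max`: the unique root of `λ g(x) = 1`.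
[cite: Economou1983, §6.2.3 eqs. (6.46)–(6.48) with §6.1 eq. (6.9)] -/
theorem existsUnique_eigenvalue_above (hE : Measurable E) {B : ℝ} (hB : ∀ p, |E p| ≤ B)
    (hEmax : ∀ p, E p ≤ Emax) {u : Lp ℂ 2 m} (hu : u ≠ 0)
    (hdiv : ∫⁻ p, ENNReal.ofReal (‖u p‖ ^ 2 / (Emax - E p)) ∂m = ∞) {lam : ℝ} (hlam : 0 < lam) :
    ∃! x : ℝ, Emax < x ∧
      ∃ ψ : Lp ℂ 2 m, ψ ≠ 0 ∧ perturb₁ (bandOp m E) (lam : ℂ) u u ψ = (x : ℂ) • ψ := by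
  -- eigenvalue at x > E_max  ⇔  λ g(x) = 1
  have key : ∀ x, Emax < x →
      ((∃ ψ : Lp ℂ 2 m, ψ ≠ 0 ∧ perturb₁ (bandOp m E) (lam : ℂ) u u ψ = (x : ℂ) • ψ) ↔
        lam * edgeFn m E u x = 1) := fun x hx => by
    have hz := (resolvent_bandOp (m := m) hE hB (sub_pos.2 hx) (dist_le_of_above hEmax hx)).1
    rw [hasEigenvector_perturb₁_iff hz, inner_resolvent_bandOp_self hE hB hEmax hx, ← Complex.ofReal_mul,
      ← Complex.ofReal_one, Complex.ofReal_inj]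
  -- the real equation λ g = 1 has exactly one root above the band
  have hroot : ∃! x : ℝ, Emax < x ∧ lam * edgeFn m E u x = 1 := by
    refine existsUnique_of_strictAnti_surj ((continuousOn_edgeFn hE hEmax u).const_smul lam |>.congr
      fun x _ => by simp [smul_eq_mul]) (fun x y hx hxy => ?_) ?_ ?_
    · exact mul_lt_mul_of_pos_left (edgeFn_strictAnti hE hEmax hx hxy hu) hlam
    · obtain ⟨x, hx, hBx⟩ := edgeFn_unbounded hE hEmax u hdiv (1 / lam)
      exact ⟨x, hx, by rw [← div_le_iff₀' hlam]; exact hBx⟩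
    · -- at infinity: g(x) ≤ ‖u‖²/(x − E_max) < 1/λ for x large
      set I := ∫ p, ‖u p‖ ^ 2 ∂m with hI
      have hI0 : 0 ≤ I := integral_nonneg fun p => sq_nonneg _
      refine ⟨Emax + lam * I + 1, by nlinarith, ?_⟩
      have hx : Emax < Emax + lam * I + 1 := by nlinarith
      have h1 := edgeFn_le_div hE hEmax hx u
      rw [← hI, show Emax + lam * I + 1 - Emax = lam * I + 1 by ring] at h1
      have h2 : lam * (I / (lam * I + 1)) < 1 := by
        rw [← mul_div_assoc, div_lt_one (by nlinarith)]; linarith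
      calc lam * edgeFn m E u (Emax + lam * I + 1) ≤ lam * (I / (lam * I + 1)) :=
            mul_le_mul_of_nonneg_left h1 hlam.le
        _ < 1 := h2
  obtain ⟨x, ⟨hx, hgx⟩, huniq⟩ := hroot
  refine ⟨x, ⟨hx, (key x hx).2 hgx⟩, fun y ⟨hy, hψ⟩ => huniq y ⟨hy, (key y hy).1 hψ⟩⟩

/-- **Wrong sign: no eigenvalue above the band for `λ ≤ 0`** (`λ g(x) ≤ 0 ≠ 1`).
[cite: Economou1983, §6.2.1 case 2)] -/
theorem no_eigenvalue_above_of_nonpos (hE : Measurable E) {B : ℝ} (hB : ∀ p, |E p| ≤ B)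
    (hEmax : ∀ p, E p ≤ Emax) (u : Lp ℂ 2 m) {lam : ℝ} (hlam : lam ≤ 0) {x : ℝ} (hx : Emax < x) :
    ¬ ∃ ψ : Lp ℂ 2 m, ψ ≠ 0 ∧ perturb₁ (bandOp m E) (lam : ℂ) u u ψ = (x : ℂ) • ψ := by
  have hz := (resolvent_bandOp (m := m) hE hB (sub_pos.2 hx) (dist_le_of_above hEmax hx)).1
  rw [hasEigenvector_perturb₁_iff hz, inner_resolvent_bandOp_self hE hB hEmax hx, ← Complex.ofReal_mul,
    ← Complex.ofReal_one, Complex.ofReal_inj]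
  have := mul_nonpos_of_nonpos_of_nonneg hlam (edgeFn_nonneg hEmax hx u)
  intro h; rw [h] at this; exact absurd this (not_le.2 one_pos)

end Above

end FiniteRank

end Literature.MathematicalPhysics.KineticTheory
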